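import Mathlib
import HarnessLib
import Literature.Analysis.FluidPDE.SelfSimilar
import Literature.Analysis.FluidPDE.TypeIAncientMild
import Summits.NavierStokesRegularity.NavierStokesRegularity.Theorems.QuarterLogPincerThinCascadeDefs

/-!
# Route `QuarterLogPincer` — objects of the T1 ANATOMY (v1.4/v1.5) of the EDGE line `truncation_edge` of crux `TypeIQuantSubcubicExp`
  (stmt-NavierStokesRegularity-24077): P1 `CutoffData`, P2 `FrameBootstrap`, P3 `SupShadowing` (= P3a `SupShadowingCore` ∘ P3b
  `SupShadowingLocal`), P4 `ExteriorCube`, and their closed `Stub…` forms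

Definitions ONLY — the piece objects into which the line author (**ns-idea-7 g9**, workfile
`Cruxes/TypeIQuantSubcubicExp/Lines/truncation_edge.lean` v1.4–v1.6, commits 6b783059033a ff.; idea-crit-4 of record) cut the one
remaining input T1 `StubFarFieldTruncation` (`stubFarFieldTruncation_of_anatomy : StubCutoffData → StubFrameBootstrap →
StubSupShadowing → StubExteriorCube → StubFarFieldTruncation` and `stubSupShadowing_of_parts : StubSupShadowingCore →
StubSupShadowingLocal → StubSupShadowing`, kernel-checked in the workfile), copied VERBATIM and only re-homed into an importable
module (crux workfiles under `Cruxes/` are not importable from `Theorems/`), exactly as `QuarterLogPincerTruncationEdgeDefs` (p660448)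
re-homes T1/T3/T4.  Same namespace as the line (`…Cruxes.TypeIQuantSubcubicExp.TruncationEdge`), same names, same bodies.  Re-homed by
the pub-ns-dss typer (g35) so that the pieces can be discharged BY NAME in Theorems files.

HONEST FRAME: an EDGE (calibration) line; nothing in this file is asserted — objects only; T1, 24077, 22144, W7 and Navier–Stokes
regularity are OPEN / not proved.
-/

noncomputable section

-- the summit-side namespace repeats a component by design (D-0017)
set_option linter.dupNamespace false

namespace Summit.NavierStokesRegularity.NavierStokesRegularity.Cruxes.TypeIQuantSubcubicExp.TruncationEdge

open MeasureTheory Set Function Metric Filter Topology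
open scoped ENNReal NNReal
open Literature.Analysis Literature.Analysis.FluidPDE
open Summit.NavierStokesRegularity.NavierStokesRegularity.Cruxes.TypeIQuantSubcubicExp.ThinCascade (TaoFrame)

/-! ### v1.4 — T1 ANATOMY: four standard pieces and their kernel-checked composition -/

/-- (P1) **CUT-OFF DATA** for the field `v` at time `−1` (Bogovskiĭ-corrected cut-off at radius `ρ`):
for some `K ≥ 0` and every `ρ ≥ 1` a smooth, divergence-free, compactly supported datum `u₀`
with `tsupport u₀ ⊆ B̄(0, 2ρ)`, `sup_x ‖u₀(x) − v(−1,x)‖ ≤ K/ρ` (the removed tail and the corrector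
are POINTWISE small: `|v(−1,x)| ≤ A/(|x|+1)`) and energy `‖u₀‖₂² ≤ K ρ`.
NS-generic given the envelope; tree tools: `MaoOhTao.exists_smooth_divInverse_shell` (qualitative
Bogovskiĭ on a shell, PROVED), `bogovskii_annulus_smooth_corrector` (named fact, `L^q` gradient bounds)
plus a scale-`ρ` Morrey/Sobolev sup bound for the corrector; or the Leray projection of `χ_ρ v(−1)`
with the dipole tail absorbed (see the card). [line object of `Cruxes/TypeIQuantSubcubicExp/Lines/truncation_edge.lean` v1.4–v1.5 (ns-idea-7 g9), verbatim] -/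
def CutoffData (v : ℝ → EuclideanSpace ℝ (Fin 3) → EuclideanSpace ℝ (Fin 3)) : Prop :=
  ∃ K : ℝ, 0 ≤ K ∧ ∀ ρ : ℝ, 1 ≤ ρ →
    ∃ u₀ : EuclideanSpace ℝ (Fin 3) → EuclideanSpace ℝ (Fin 3),
      ContDiff ℝ (⊤ : ℕ∞) u₀ ∧ VectorCalculus.IsDivFree u₀ ∧ HasCompactSupport u₀ ∧
      tsupport u₀ ⊆ Metric.closedBall (0 : EuclideanSpace ℝ (Fin 3)) (2 * ρ) ∧
      (∀ x, ‖u₀ x - v (-1) x‖ ≤ K / ρ) ∧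
      (∫⁻ x, ‖u₀ x‖ₑ ^ 2 ≤ ENNReal.ofReal (K * ρ))

/-- (P2) **FRAME BOOTSTRAP** (NS-generic continuation under a self-improving closeness barrier; no
Type-I content).  Smooth, divergence-free, compactly supported datum `u₀`; a reference field `V`
jointly continuous on `[0,T] × ℝ³`, bounded, uniformly small at spatial infinity; `u₀` is `δ/2`-close
to `V(0)`; and the A PRIORI IMPROVEMENT: every Tao-frame solution from `u₀` on a sub-slab `[0,T']`
that is `2δ`-close to `V` is `δ`-close.  THEN a Tao-frame solution from `u₀` on `[0,T]`, `δ`-close to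
`V`, exists.  Road: Kato/`tao2011_smooth_local_existence` maximal smooth solution, Tao cover
`tao2011_hasBoundedSobolevNormsOn` on closed sub-slabs, continuity of `t ↦ sup_x ‖u − V‖`, the
`L^∞` blow-up criterion (`exists_not_isBoundedNearTop_of_isMaximalSmoothSolution`-type), Serrin
uniqueness to glue restarts. [line object of `Cruxes/TypeIQuantSubcubicExp/Lines/truncation_edge.lean` v1.4–v1.5 (ns-idea-7 g9), verbatim] -/
def FrameBootstrap : Prop :=
  ∀ (T δ : ℝ) (u₀ : EuclideanSpace ℝ (Fin 3) → EuclideanSpace ℝ (Fin 3))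
    (V : ℝ → EuclideanSpace ℝ (Fin 3) → EuclideanSpace ℝ (Fin 3)), 0 < T → 0 < δ →
    ContDiff ℝ (⊤ : ℕ∞) u₀ → VectorCalculus.IsDivFree u₀ → HasCompactSupport u₀ →
    ContinuousOn (uncurry V) (Set.Icc 0 T ×ˢ Set.univ) →
    (∃ B : ℝ, ∀ t ∈ Set.Icc 0 T, ∀ x, ‖V t x‖ ≤ B) →
    (∀ η : ℝ, 0 < η → ∃ R : ℝ, ∀ t ∈ Set.Icc 0 T, ∀ x : EuclideanSpace ℝ (Fin 3),
        R ≤ ‖x‖ → ‖V t x‖ ≤ η) →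
    (∀ x, ‖u₀ x - V 0 x‖ ≤ δ / 2) →
    (∀ T' ∈ Set.Ioc 0 T, ∀ (u : ℝ → EuclideanSpace ℝ (Fin 3) → EuclideanSpace ℝ (Fin 3))
        (p : ℝ → EuclideanSpace ℝ (Fin 3) → ℝ), TaoFrame T' u p → u 0 = u₀ →
        (∀ t ∈ Set.Icc 0 T', ∀ x, ‖u t x - V t x‖ ≤ 2 * δ) →
        ∀ t ∈ Set.Icc 0 T', ∀ x, ‖u t x - V t x‖ ≤ δ) →
    ∃ (u : ℝ → EuclideanSpace ℝ (Fin 3) → EuclideanSpace ℝ (Fin 3))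
      (p : ℝ → EuclideanSpace ℝ (Fin 3) → ℝ),
      TaoFrame T u p ∧ u 0 = u₀ ∧ ∀ t ∈ Set.Icc 0 T, ∀ x, ‖u t x - V t x‖ ≤ δ

/-- (P3) **SUP SHADOWING WITH POLYNOMIAL LOSS** (the Type-I-specific a priori estimate; THE HEART of
T1).  For the Type-I ancient mild field `v` (rate `M`, envelope `A`): given the data accuracy constant
`K₀` and a target accuracy `δ ∈ (0,1]` there are `κ ≥ 0`, `K ≥ 1` such that for `ε ∈ (0,1/2]`,
`ρ ≥ K ε^{−κ}`, any datum `u₀` with `sup ‖u₀ − v(−1)‖ ≤ K₀/ρ`, and any Tao-frame solution `u` from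
`u₀` on `[0,T'] ⊆ [0,1−ε]` which is `2δ`-close to `v(·−1)` (bootstrap hypothesis):
(a) `u` is `δ`-close to `v(·−1)` everywhere; (c) OUTSIDE `B(0,ρ)` the closeness is `K/ρ`
(no amplification away from the core); (b) the `L³(B̄(0,2ρ))` norm of `u(t) − v(t−1)` is at most
`k` with `k³ ≤ K(1 + log ρ)`.  Road: the difference `w` solves the Oseen-mild perturbation equation
around `v`; (a) = Henry-type singular Gronwall for `sup_x‖w‖` with kernel `C(t−σ)^{−1/2}(M(1−σ)^{−1/2} + 2)`
across `log₂(1/ε)` dyadic blocks: growth `ε^{−κ(M)}`, `κ(M) = O((M+1)²)`, so `‖w‖_∞ ≤ (K₀/ρ)·K_G ε^{−κ} ≤ δ`;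
(c) = two-region estimate with the pointwise Oseen bound `|∇O(t,z)| ≲ (|z|+√t)^{−4}` and
`|v| ≤ A/|y|` away from the core; (b) = integrate the resulting profile. [line object of `Cruxes/TypeIQuantSubcubicExp/Lines/truncation_edge.lean` v1.4–v1.5 (ns-idea-7 g9), verbatim] -/
def SupShadowing (v : ℝ → EuclideanSpace ℝ (Fin 3) → EuclideanSpace ℝ (Fin 3)) : Prop :=
  ∀ K₀ δ : ℝ, 0 ≤ K₀ → 0 < δ → δ ≤ 1 → ∃ κ K : ℝ, 0 ≤ κ ∧ 1 ≤ K ∧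
    ∀ ε ∈ Set.Ioc (0 : ℝ) (1 / 2), ∀ ρ : ℝ, K * ε ^ (-κ) ≤ ρ →
    ∀ u₀ : EuclideanSpace ℝ (Fin 3) → EuclideanSpace ℝ (Fin 3),
      (∀ x, ‖u₀ x - v (-1) x‖ ≤ K₀ / ρ) →
    ∀ T' ∈ Set.Ioc (0 : ℝ) (1 - ε),
    ∀ (u : ℝ → EuclideanSpace ℝ (Fin 3) → EuclideanSpace ℝ (Fin 3))
      (p : ℝ → EuclideanSpace ℝ (Fin 3) → ℝ), TaoFrame T' u p → u 0 = u₀ →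
      (∀ t ∈ Set.Icc 0 T', ∀ x, ‖u t x - v (t - 1) x‖ ≤ 2 * δ) →
      (∀ t ∈ Set.Icc 0 T', ∀ x, ‖u t x - v (t - 1) x‖ ≤ δ) ∧
      (∀ t ∈ Set.Icc 0 T', ∀ x : EuclideanSpace ℝ (Fin 3), ρ ≤ ‖x‖ → ‖u t x - v (t - 1) x‖ ≤ K / ρ) ∧
      (∃ k : ℝ, 0 ≤ k ∧ k ^ 3 ≤ K * (1 + Real.log ρ) ∧ ∀ t ∈ Set.Icc 0 T',
        eLpNorm ((Metric.closedBall (0 : EuclideanSpace ℝ (Fin 3)) (2 * ρ)).indicator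
            (fun x => u t x - v (t - 1) x)) 3 volume ≤ ENNReal.ofReal k)

/-- (P4) **EXTERIOR CUBE** (NS-generic far-field `L³` control; no Type-I content).  Given constants
`K₀, K₁ ≥ 0` there are `ρ₀ ≥ 1`, `K ≥ 0` such that for `ρ ≥ ρ₀`, every smooth datum `u₀` supported in
`B̄(0,2ρ)` with energy `‖u₀‖₂² ≤ K₁ρ` and `sup‖u₀‖ ≤ K₀`, and every Tao-frame solution `u` from `u₀` on
`[0,T'] ⊆ [0,1]` obeying the OUTER SUP BOUND `‖u(t,x)‖ ≤ K₀/ρ` for `‖x‖ ≥ ρ`, the exterior norm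
`‖u(t)‖_{L³(|x| > 2ρ)}` is at most `k`, `k³ ≤ K(1 + log ρ)`.  Road: Oseen-mild formula for `u`
(`NSLerayOseenRepresentation`); heat leakage across `|x| = 2ρ` costs `K₀ ρ^{−1/3}` in `L³`; Duhamel
sources in `B(ρ)` act through `|∇O| ≲ |x−y|^{−4}` with total strength `∫‖u(σ)‖₂² ≤ K₁ρ` (energy
inequality): `L³(|x|>2ρ)`-norm `≲ K₁ ρ^{−2}`; sources outside `B(ρ)` carry the small factor `K₀/ρ`
(`‖∇O(t)‖_{L¹} ≲ t^{−1/2}`) and are absorbed for `ρ ≥ ρ₀`. [line object of `Cruxes/TypeIQuantSubcubicExp/Lines/truncation_edge.lean` v1.4–v1.5 (ns-idea-7 g9), verbatim] -/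
def ExteriorCube : Prop :=
  ∀ K₀ K₁ : ℝ, 0 ≤ K₀ → 0 ≤ K₁ → ∃ ρ₀ K : ℝ, 1 ≤ ρ₀ ∧ 0 ≤ K ∧ ∀ ρ : ℝ, ρ₀ ≤ ρ →
    ∀ u₀ : EuclideanSpace ℝ (Fin 3) → EuclideanSpace ℝ (Fin 3),
      ContDiff ℝ (⊤ : ℕ∞) u₀ → HasCompactSupport u₀ →
      tsupport u₀ ⊆ Metric.closedBall (0 : EuclideanSpace ℝ (Fin 3)) (2 * ρ) →
      (∫⁻ x, ‖u₀ x‖ₑ ^ 2 ≤ ENNReal.ofReal (K₁ * ρ)) → (∀ x, ‖u₀ x‖ ≤ K₀) →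
    ∀ T' ∈ Set.Ioc (0 : ℝ) 1,
    ∀ (u : ℝ → EuclideanSpace ℝ (Fin 3) → EuclideanSpace ℝ (Fin 3))
      (p : ℝ → EuclideanSpace ℝ (Fin 3) → ℝ), TaoFrame T' u p → u 0 = u₀ →
      (∀ t ∈ Set.Icc 0 T', ∀ x : EuclideanSpace ℝ (Fin 3), ρ ≤ ‖x‖ → ‖u t x‖ ≤ K₀ / ρ) →
      ∃ k : ℝ, 0 ≤ k ∧ k ^ 3 ≤ K * (1 + Real.log ρ) ∧ ∀ t ∈ Set.Icc 0 T',
        eLpNorm ((Metric.closedBall (0 : EuclideanSpace ℝ (Fin 3)) (2 * ρ))ᶜ.indicator (u t)) 3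
          volume ≤ ENNReal.ofReal k

/-- Registered form of P1 (closed statement). [line object of `Cruxes/TypeIQuantSubcubicExp/Lines/truncation_edge.lean` v1.4–v1.5 (ns-idea-7 g9), verbatim] -/
def StubCutoffData : Prop :=
  ∀ (M A : ℝ) (v : ℝ → EuclideanSpace ℝ (Fin 3) → EuclideanSpace ℝ (Fin 3)),
    0 ≤ A → IsTypeIAncientMild M v → HasTypeIDecay A v → CutoffData v

/-- Registered form of P2 (closed statement; it is already closed). [line object of `Cruxes/TypeIQuantSubcubicExp/Lines/truncation_edge.lean` v1.4–v1.5 (ns-idea-7 g9), verbatim] -/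
def StubFrameBootstrap : Prop := FrameBootstrap

/-- Registered form of P3 (closed statement). [line object of `Cruxes/TypeIQuantSubcubicExp/Lines/truncation_edge.lean` v1.4–v1.5 (ns-idea-7 g9), verbatim] -/
def StubSupShadowing : Prop :=
  ∀ (M A : ℝ) (v : ℝ → EuclideanSpace ℝ (Fin 3) → EuclideanSpace ℝ (Fin 3)),
    IsTypeIAncientMild M v → HasTypeIDecay A v → SupShadowing v

/-- Registered form of P4 (closed statement; it is already closed). [line object of `Cruxes/TypeIQuantSubcubicExp/Lines/truncation_edge.lean` v1.4–v1.5 (ns-idea-7 g9), verbatim] -/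
def StubExteriorCube : Prop := ExteriorCube

/-! ### v1.5 — P3 = P3a (Type-I core shadowing) ∘ P3b (localisation): objects -/

/-- (P3a) **SUP SHADOWING CORE** — the only place where the Type-I RATE enters T1: a Tao-frame
solution from data `K₀/ρ`-close to `v(−1)` which is a priori `2`-close to `v(·−1)` on `[0,T']`,
`T' ≤ 1 − ε`, is in fact `(K/ρ)·ε^{−κ}`-close — a POLYNOMIAL loss in `1/ε`, with `κ = κ(M)`.
Mechanism: on the dyadic block `[1−2^{−j}, 1−2^{−j−1}]` the reference `v(·−1)` is bounded by
`M 2^{(j+1)/2}`, so the tree's mild sup-stability core costs the SCALE-INVARIANT factor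
`G(M) = 2 exp(36 C₀² (8M² + 9))` per block (exponent `(2B_j+3)² · 2^{−j−1} ≤ 8M² + 9`); restarting the
Oseen integral equation at each block boundary (no memory term) gives `G^{j+1}` after `j+1` blocks,
and `2^j ≤ 1/ε` turns `G^j` into `ε^{−log₂ G}`. [line object of `Cruxes/TypeIQuantSubcubicExp/Lines/truncation_edge.lean` v1.4–v1.5 (ns-idea-7 g9), verbatim] -/
def SupShadowingCore (v : ℝ → EuclideanSpace ℝ (Fin 3) → EuclideanSpace ℝ (Fin 3)) : Prop :=
  ∀ K₀ : ℝ, 0 ≤ K₀ → ∃ κ K : ℝ, 0 ≤ κ ∧ 0 ≤ K ∧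
    ∀ ε ∈ Set.Ioc (0 : ℝ) (1 / 2), ∀ ρ : ℝ, 1 ≤ ρ →
    ∀ u₀ : EuclideanSpace ℝ (Fin 3) → EuclideanSpace ℝ (Fin 3), (∀ x, ‖u₀ x - v (-1) x‖ ≤ K₀ / ρ) →
    ∀ T' ∈ Set.Ioc (0 : ℝ) (1 - ε),
    ∀ (u : ℝ → EuclideanSpace ℝ (Fin 3) → EuclideanSpace ℝ (Fin 3)) (p : ℝ → EuclideanSpace ℝ (Fin 3) → ℝ),
      TaoFrame T' u p → u 0 = u₀ →
      (∀ t ∈ Set.Icc 0 T', ∀ x, ‖u t x - v (t - 1) x‖ ≤ 2) →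
      ∀ t ∈ Set.Icc 0 T', ∀ x, ‖u t x - v (t - 1) x‖ ≤ K / ρ * ε ^ (-κ)

/-- Registered closed form of (P3a): the Type-I rate alone gives the polynomial-loss shadowing. [line object of `Cruxes/TypeIQuantSubcubicExp/Lines/truncation_edge.lean` v1.5 (ns-idea-7 g9), verbatim] -/
def StubSupShadowingCore : Prop :=
  ∀ (M : ℝ) (v : ℝ → EuclideanSpace ℝ (Fin 3) → EuclideanSpace ℝ (Fin 3)),
    IsTypeIAncientMild M v → SupShadowingCore v

/-- (P3b) **SUP SHADOWING — LOCALISATION** (the envelope enters here, the rate does not): once the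
frame solution is GLOBALLY `δ'`-close to `v(·−1)` with `δ' ≤ δ₀` small and the data error is
`≤ K₀/ρ ≤ δ'`, the difference obeys the OUTER PROFILE `‖u(t,x) − v(t−1,x)‖ ≤ K/ρ` for `‖x‖ ≥ ρ`
(`ρ ≥ ρ₁`) and the log-shaped budget `‖1_{B̄(0,2ρ)}(u(t) − v(t−1))‖₃ ≤ k`, `k³ ≤ K(1 + log ρ)`.
Road (card §P3 STEP 2–3): two-region estimate for the Oseen-mild difference equation — FAR sources
through the kernel decay `‖K(σ,z)[a,b]‖ ≤ C₀(σ+|z|²)^{−2}|a||b|` (tree `exists_norm_oseenKernel_three_le`,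
`norm_oseenDuhamel_near_le_of_norm`, `OseenDuhamelMorreyFarField`), NEAR sources through the slice
estimate with the small factors `A/L`, `δ'` (tree `norm_oseenDuhamel_le_const`, the `Θ(R)`-bootstrap
of `BoundedMildSpatialDecay`), giving the profile `2K₀/ρ + 8Lδ'/|x|`, whose cube over
`4L ≤ |x| ≤ 2ρ` is the allowed `K(1 + log ρ)`. [line object of `Cruxes/TypeIQuantSubcubicExp/Lines/truncation_edge.lean` v1.4–v1.5 (ns-idea-7 g9), verbatim] -/
def SupShadowingLocal (v : ℝ → EuclideanSpace ℝ (Fin 3) → EuclideanSpace ℝ (Fin 3)) : Prop :=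
  ∀ K₀ : ℝ, 0 ≤ K₀ → ∃ δ₀ ρ₁ K : ℝ, 0 < δ₀ ∧ δ₀ ≤ 1 ∧ 1 ≤ ρ₁ ∧ 0 ≤ K ∧
    ∀ δ' : ℝ, 0 < δ' → δ' ≤ δ₀ → ∀ ρ : ℝ, ρ₁ ≤ ρ → K₀ / ρ ≤ δ' →
    ∀ u₀ : EuclideanSpace ℝ (Fin 3) → EuclideanSpace ℝ (Fin 3), (∀ x, ‖u₀ x - v (-1) x‖ ≤ K₀ / ρ) →
    ∀ T' ∈ Set.Ioo (0 : ℝ) 1,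
    ∀ (u : ℝ → EuclideanSpace ℝ (Fin 3) → EuclideanSpace ℝ (Fin 3)) (p : ℝ → EuclideanSpace ℝ (Fin 3) → ℝ),
      TaoFrame T' u p → u 0 = u₀ →
      (∀ t ∈ Set.Icc 0 T', ∀ x, ‖u t x - v (t - 1) x‖ ≤ δ') →
      (∀ t ∈ Set.Icc 0 T', ∀ x : EuclideanSpace ℝ (Fin 3), ρ ≤ ‖x‖ → ‖u t x - v (t - 1) x‖ ≤ K / ρ) ∧
      (∃ k : ℝ, 0 ≤ k ∧ k ^ 3 ≤ K * (1 + Real.log ρ) ∧ ∀ t ∈ Set.Icc 0 T',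
        eLpNorm ((Metric.closedBall (0 : EuclideanSpace ℝ (Fin 3)) (2 * ρ)).indicator
            (fun x => u t x - v (t - 1) x)) 3 volume ≤ ENNReal.ofReal k)

/-- Registered closed form of (P3b). [line object of `Cruxes/TypeIQuantSubcubicExp/Lines/truncation_edge.lean` v1.4–v1.5 (ns-idea-7 g9), verbatim] -/
def StubSupShadowingLocal : Prop :=
  ∀ (M A : ℝ) (v : ℝ → EuclideanSpace ℝ (Fin 3) → EuclideanSpace ℝ (Fin 3)),
    IsTypeIAncientMild M v → HasTypeIDecay A v → SupShadowingLocal v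

/-! ### v1.7 — P3b = P3b′ (pointwise outer profile) + profile integration: objects -/

/-- (P3b′) **SUP-SHADOWING PROFILE** (pointwise, NS-generic given the envelope): in the regime of
P3b (`δ' ≤ δ₀`, `ρ ≥ ρ₁`, `K₀/ρ ≤ δ'`, frame solution from `K₀/ρ`-close data, globally `δ'`-close to
`v(·−1)` on `[0,T'] ⊆ [0,1)`), the difference obeys the POINTWISE two-term profile
`‖u(t,x) − v(t−1,x)‖ ≤ K/ρ + K/(‖x‖+1)` for all `x`.  (Near the core this is implied by `δ' ≤ 1`;
the content is the outer region `‖x‖ ≫ A/δ'`, where the linearisation around `v` has the small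
coefficient `|v| ≤ A/‖x‖` and the Oseen kernel `|∇O(t,z)| ≲ (‖z‖+√t)^{-4}` splits near/far sources —
a dyadic-radius bootstrap as in `BoundedMildSpatialDecay`.) [line object of `Cruxes/TypeIQuantSubcubicExp/Lines/truncation_edge.lean` v1.7 (ns-idea-7 g9), verbatim] -/
def SupShadowingProfile (v : ℝ → EuclideanSpace ℝ (Fin 3) → EuclideanSpace ℝ (Fin 3)) : Prop :=
  ∀ K₀ : ℝ, 0 ≤ K₀ → ∃ δ₀ ρ₁ K : ℝ, 0 < δ₀ ∧ δ₀ ≤ 1 ∧ 1 ≤ ρ₁ ∧ 0 ≤ K ∧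
    ∀ δ' : ℝ, 0 < δ' → δ' ≤ δ₀ → ∀ ρ : ℝ, ρ₁ ≤ ρ → K₀ / ρ ≤ δ' →
    ∀ u₀ : EuclideanSpace ℝ (Fin 3) → EuclideanSpace ℝ (Fin 3), (∀ x, ‖u₀ x - v (-1) x‖ ≤ K₀ / ρ) →
    ∀ T' ∈ Set.Ioo (0 : ℝ) 1,
    ∀ (u : ℝ → EuclideanSpace ℝ (Fin 3) → EuclideanSpace ℝ (Fin 3)) (p : ℝ → EuclideanSpace ℝ (Fin 3) → ℝ),
      TaoFrame T' u p → u 0 = u₀ →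
      (∀ t ∈ Set.Icc 0 T', ∀ x, ‖u t x - v (t - 1) x‖ ≤ δ') →
      ∀ t ∈ Set.Icc 0 T', ∀ x : EuclideanSpace ℝ (Fin 3), ‖u t x - v (t - 1) x‖ ≤ K / ρ + K / (‖x‖ + 1)

/-- Registered closed form of (P3b′). [line object of `Cruxes/TypeIQuantSubcubicExp/Lines/truncation_edge.lean` v1.7 (ns-idea-7 g9), verbatim] -/
def StubSupShadowingProfile : Prop :=
  ∀ (M A : ℝ) (v : ℝ → EuclideanSpace ℝ (Fin 3) → EuclideanSpace ℝ (Fin 3)),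
    IsTypeIAncientMild M v → HasTypeIDecay A v → SupShadowingProfile v

end Summit.NavierStokesRegularity.NavierStokesRegularity.Cruxes.TypeIQuantSubcubicExp.TruncationEdge

end
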